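import Literature.MathematicalPhysics.QuantumFieldTheory.OSSkeletonFunctional
import Literature.Analysis.FunctionSpaces.SchwartzExchange
import HarnessLib

/-!
# Superposed OS vectors: `v(∫ w(x) G(x) dx) = ∫ w(x) v(G(x)) dx`

Osterwalder–Schrader II (Comm. Math. Phys. 42 (1975)), Ch. V (5.3)–(5.4) and Ch. VI.1: the vectors
`Ψ(f)` of the OS Hilbert space depend linearly and continuously on the test function, and OS
freely pass between test functions given as parameter integrals (time averages, superpositions
over the other variables) and the corresponding integrals of vectors. This file proves the
rigorous form needed for the Ch. VI.1 estimates (where norms of *superposed* vectors are bounded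
through E0' applied to the superposed *test function*): if `K ∈ 𝓢` is given pointwise by
`K(y) = ∫ w(x) G(x)(y) dμ(x)` for a continuous family `G` of positive-time test functions with
polynomially growing seminorms and a polynomially integrable weight `w`, and the OS vectors of
`G(x)` are polynomially bounded in norm, then

  `v(K) = ∫ w(x) v(G(x)) dμ(x)`   (`ι_δ_mkGen_eq_integral`)

as a Bochner integral in the OS Hilbert space. Proof: test against the dense vectors `v(F)`:
`⟪v(F), v(K)⟫ = 𝔖(ΘF* ⊗ K)` and `H ↦ 𝔖(ΘF* ⊗ H)` is a tempered distribution, which commutes with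
the Schwartz-valued integral by the tree's `SchwartzMap.apply_eq_integral_of_forall_apply_eq_integral`
(`SchwartzExchange`).

## References

* K. Osterwalder, R. Schrader, *Axioms for Euclidean Green's functions II*, Comm. Math. Phys.
  42 (1975) 281–305, Ch. V (5.3)–(5.4), Ch. VI.1. [OsterwalderSchraderCMP1975]
-/

noncomputable section

open MeasureTheory Set Filter
open _root_.Topology
open scoped InnerProductSpace NNReal ComplexConjugate SchwartzMap

namespace Literature.MathematicalPhysics.QuantumFieldTheory

variable {d : ℕ} [NeZero d]

open Literature.MathematicalPhysics.QuantumLattice (SchwingerFamily IsPositiveTimeMulti)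
open Literature.MathematicalPhysics.QuantumLattice.SchwingerFamily
open Literature.MathematicalPhysics.QuantumLattice.SchwingerFamily.OSSpace

variable (𝔖 : SchwingerFamily (EuclideanSpace ℝ (Fin d)))

/-- **The tempered distribution `H ↦ 𝔖_{m+n}(ΘF* ⊗ H)`** (a continuous linear functional on the
`n`-point test functions, for a fixed `m`-point `F`). [folklore] -/
def pairingRightCLM {m : ℕ} (F : 𝓢((Fin m → EuclideanSpace ℝ (Fin d)), ℂ)) (n : ℕ) :
    𝓢((Fin n → EuclideanSpace ℝ (Fin d)), ℂ) →L[ℂ] ℂ where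
  toFun H := 𝔖 (m + n) ((QuantumLattice.osAdjoint F).appendTensor H)
  map_add' H H' := by rw [SchwartzMap.appendTensor_add_right, map_add]
  map_smul' c H := by rw [SchwartzMap.appendTensor_smul_right, map_smul]; rfl
  cont := (𝔖 (m + n)).continuous.comp
    (QuantumLattice.continuous_appendTensor.comp (continuous_const.prodMk continuous_id))

/-- Values of `pairingRightCLM`. [folklore] -/
@[simp] theorem pairingRightCLM_apply {m : ℕ} (F : 𝓢((Fin m → EuclideanSpace ℝ (Fin d)), ℂ)) {n : ℕ}
    (H : 𝓢((Fin n → EuclideanSpace ℝ (Fin d)), ℂ)) :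
    pairingRightCLM 𝔖 F n H = 𝔖 (m + n) ((QuantumLattice.osAdjoint F).appendTensor H) := rfl

variable {𝔖} (hE2 : 𝔖.IsOSReflectionPositive)

/-- Inner products of generator vectors are OS pairings: `⟪v(F), v(H)⟫ = 𝔖(ΘF* ⊗ H)`. [folklore] -/
theorem inner_ι_δ_mkGen {m n : ℕ} (F : 𝓢((Fin m → EuclideanSpace ℝ (Fin d)), ℂ)) (hF : IsPositiveTimeMulti F)
    (H : 𝓢((Fin n → EuclideanSpace ℝ (Fin d)), ℂ)) (hH : IsPositiveTimeMulti H) :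
    ⟪ι 𝔖 hE2 (δ 𝔖 hE2 (mkGen F hF)), ι 𝔖 hE2 (δ 𝔖 hE2 (mkGen H hH))⟫_ℂ = pairingRightCLM 𝔖 F n H := by
  rw [inner_ι_ι, inner_δ_δ, genPairing_eq]
  rfl

section Main

variable {X : Type*} [NormedAddCommGroup X] [MeasurableSpace X] [OpensMeasurableSpace X]
  [SecondCountableTopology X] {μ : Measure X}

/-- **Superposed OS vectors**: `v(K) = ∫ w(x) v(G(x)) dμ(x)` when `K(y) = ∫ w(x) G(x)(y) dμ(x)`
pointwise (hypotheses as in the module docstring). [cite: OsterwalderSchraderCMP1975, Ch. V (5.3)–(5.4), Ch. VI.1] -/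
theorem ι_δ_mkGen_eq_integral {n : ℕ} (G : X → 𝓢((Fin n → EuclideanSpace ℝ (Fin d)), ℂ)) (hG : Continuous G)
    (hgrowth : ∀ k l : ℕ, ∃ (C : ℝ) (N : ℕ), ∀ x, SchwartzMap.seminorm ℂ k l (G x) ≤ C * (1 + ‖x‖) ^ N)
    (hpos : ∀ x, IsPositiveTimeMulti (G x))
    (hv : ∃ (C : ℝ) (N : ℕ), ∀ x, ‖ι 𝔖 hE2 (δ 𝔖 hE2 (mkGen (G x) (hpos x)))‖ ≤ C * (1 + ‖x‖) ^ N)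
    (w : X → ℂ) (hw : Continuous w) (hwi : ∀ N : ℕ, Integrable (fun x => (1 + ‖x‖) ^ N * ‖w x‖) μ)
    (K : 𝓢((Fin n → EuclideanSpace ℝ (Fin d)), ℂ)) (hK : ∀ y, K y = ∫ x, w x * G x y ∂μ)
    (hKpos : IsPositiveTimeMulti K) :
    ι 𝔖 hE2 (δ 𝔖 hE2 (mkGen K hKpos)) = ∫ x, w x • ι 𝔖 hE2 (δ 𝔖 hE2 (mkGen (G x) (hpos x))) ∂μ := by
  set vG : X → OSHilbert 𝔖 hE2 := fun x => ι 𝔖 hE2 (δ 𝔖 hE2 (mkGen (G x) (hpos x))) with hvG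
  -- integrability of the vector-valued integrand
  have hvGc : Continuous vG := continuous_ι_δ_mkGen hE2 hG hpos
  obtain ⟨C, N, hC⟩ := hv
  have hint : Integrable (fun x => w x • vG x) μ := by
    refine ((hwi N).const_mul |C|).mono' ((hw.smul hvGc).aestronglyMeasurable) (Eventually.of_forall fun x => ?_)
    rw [norm_smul]
    calc ‖w x‖ * ‖vG x‖ ≤ ‖w x‖ * (C * (1 + ‖x‖) ^ N) := mul_le_mul_of_nonneg_left (hC x) (norm_nonneg _)
      _ ≤ ‖w x‖ * (|C| * (1 + ‖x‖) ^ N) := by gcongr; exact le_abs_self C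
      _ = |C| * ((1 + ‖x‖) ^ N * ‖w x‖) := by ring
  -- test against the dense vectors `ι v`
  refine (ext_inner_left ℂ fun z => ?_).symm
  revert z
  have hclosed : IsClosed {z : OSHilbert 𝔖 hE2 | ⟪z, ∫ x, w x • vG x ∂μ⟫_ℂ = ⟪z, ι 𝔖 hE2 (δ 𝔖 hE2 (mkGen K hKpos))⟫_ℂ} :=
    isClosed_eq (continuous_id.inner continuous_const) (continuous_id.inner continuous_const)
  refine fun z => denseRange_ι.induction_on z hclosed fun v => ?_
  -- reduce to generators by sesquilinearity
  induction v using Finsupp.induction_linear with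
  | zero =>
      change ⟪ι 𝔖 hE2 (0 : OSSpace 𝔖 hE2), _⟫_ℂ = ⟪ι 𝔖 hE2 (0 : OSSpace 𝔖 hE2), _⟫_ℂ
      rw [map_zero, inner_zero_left, inner_zero_left]
  | add v₁ v₂ h₁ h₂ =>
      have : (ι 𝔖 hE2 (v₁ + v₂) : OSHilbert 𝔖 hE2) = ι 𝔖 hE2 v₁ + ι 𝔖 hE2 v₂ := map_add _ _ _
      rw [this, inner_add_left, inner_add_left, h₁, h₂]
  | single p c =>
      have hs : (Finsupp.single p c : OSSpace 𝔖 hE2) = c • δ 𝔖 hE2 p :=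
        (Finsupp.smul_single_one p c).symm
      rw [hs, map_smul, inner_smul_left, inner_smul_left]
      congr 1
      obtain ⟨m, ⟨F, hF⟩⟩ := p
      -- `⟪v(F), ∫ w v(G)⟫ = ∫ w ⟪v(F), v(G x)⟫ = ∫ w 𝔖(ΘF* ⊗ G x) = 𝔖(ΘF* ⊗ K) = ⟪v(F), v(K)⟫`
      rw [← integral_inner hint, show (⟨m, ⟨F, hF⟩⟩ : PosGen d) = mkGen F hF from rfl, inner_ι_δ_mkGen hE2]
      simp_rw [inner_smul_right, hvG, inner_ι_δ_mkGen hE2]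
      exact (SchwartzMap.apply_eq_integral_of_forall_apply_eq_integral (pairingRightCLM 𝔖 F n) G hG hgrowth w hw
        hwi K hK).symm

end Main

end Literature.MathematicalPhysics.QuantumFieldTheory
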